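import Literature.AlgebraicGeometry.ShimuraVarieties.UnitaryAuxiliaryTorusDatum
import HarnessLib

/-!
# Reciprocity predicates for forms of the unitary Shimura tower over a base `E ⊆ ℂ`
# (Deligne 1979, 2.2.5; Milne 2005, Def. 12.8 (62)) — the junction vocabulary of the `hodgecm-mathlib` cell

Topic `AlgebraicGeometry/ShimuraVarieties`, namespace `Literature.AlgebraicGeometry.ShimuraVarieties.UnitaryCanonicalModel`
(sequel of `UnitaryShimuraCanonicalModelPrinted` — hDel's `IsCanonicalDescentAt` at base `(L, τ)` — and of
`UnitaryAuxiliaryTorusDatum` — B-typ03's auxiliary carriers `Aux.reflexField`, `Aux.pointsOfForm`).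
DEFINITIONS ONLY (predicates with explicit parameters, two `Iff.rfl` comparison lemmas); nothing is asserted, no
named fact (D-0026 net debt 0).  The text of every declaration is VERBATIM §0/§3/§6/§7 of B-plan2's line skeleton
`B-plan/Lines/B1HeckeQuotientDescent.lean` v6 (sha16 0bd5bafbee2574a8, farm rc 0), moved into the tree at B-plan2's
request (bus 2026-08-28T01:13:22Z «typ03: PREDICATES ONLY») so that BOTH fans import ONE copy: fan B's finite Hecke
quotient descent (heads `HeckeQuotientDescentOver`, `AuxQuotientDescent`, `GaloisLegDescent…`, which stay in the
skeleton until their stubs are theorems) and fan A's `stub_reflexCompositumModel` / A-p05–A-p06 (whose inner block at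
`E := ↥E♯`, `ιE := algebraMap ↥E♯ ℂ` is `IsCanonicalDescentOver`, by `isCanonicalDescentAtReflex_iff_over`).

THE PRINT.  [Deligne1979ShimuraVarieties] 2.2.5 (transl. p. 29 L16–25): «A canonical model `M(G,X)` of `M_ℂ(G,X)` is
a form over `E(G,X)` of `M_ℂ(G,X)` [equivariant under `G(𝔸_f)`] such that for every special pair `(h, τ)` the special
points are algebraic and `σ[h, g] = [h, r(s) g]` for `art(s) = σ|E^ab`»; [Milne2005ShimuraVarieties] Def. 12.8 with
(60)–(62) (p. 114) and Rem. 12.9 (p. 115, a model over a LARGER field `E ⊇ E(G,X)` satisfying (62) for `σ` fixing `E`);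
[Deligne1971TravauxShimura] (5.11.1) (reciprocity «up to» the finite Hecke translation, the quotient step).  Here,
for the unitary tower `Sc : ComplexRecordSystem L H τ T hT K₀` of hDel (`N = 3`):

* `formPointsEquiv X` — complex points of an `E`-scheme read on `X ⊗_E ℂ` for an `E`-ALGEBRA structure on `ℂ`
  (`AlgPoints.baseChangeEquiv (algebraMap E ℂ)`; = `Aux.pointsOfForm` for `E ⊂ ℂ` an intermediate field, rfl).
* `IsCanonicalDescentOver Sc ιE M e` — (62) at the diagonal special pairs for an `E`-form `(M, e)` of `Sc.Mc`, base
  `E` read through `ιE : E →+* ℂ`, `σ ∈ Aut(ℂ/ιE E)`, `L`-idèles `s` with `art_L(s) = σ|L^ab`; at `E = L`, `ιE = τ`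
  it IS hDel's `IsCanonicalDescentAt` (`isCanonicalDescentOver_iff`, `Iff.rfl`).
* `IsCanonicalDescentUpTo Sc ιE Δ N ι` — (5.11.1): the same for a tower `N` whose complex fibres are `Δ` copies of
  `Sc.Mc_K` (cofans `ι`), conclusion «lands in SOME copy `δ'`».
* `IsCanonicalDescentOverReflex Φ Sc M e` — (62) over `E♯ = Aux.reflexField L Φ τ` with `E♯`-IDÈLES (`art_{E♯}`,
  twist `recipFactor L (finiteIdeleRelNorm L E♯ s)`), B-typ03's `Aux.IsCanonicalDescentAt` with the torus summand
  deleted — what F1 (`Aux.canonicalModel_exists_printed`) yields after the finite Hecke quotient.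
* `IsCanonicalDescentAtReflex Φ Sc M e` — (62) over `E♯` with `L`-IDÈLES (`art_L`, canonical `Algebra ↥E♯ ℂ`), the
  Galois-leg junction; `isCanonicalDescentAtReflex_iff_over` (`Iff.rfl`, farm-certified by B-plan2 v6 §7 (b)): it IS
  `IsCanonicalDescentOver Sc (algebraMap ↥E♯ ℂ) M e`.

## References
* [Deligne1979ShimuraVarieties] P. Deligne, *Variétés de Shimura: interprétation modulaire…*, PSPUM 33.2 (1979), 2.2.5, 2.3.1.
* [Milne2005ShimuraVarieties] J. S. Milne, *Introduction to Shimura varieties* (2005), Def. 12.8 (60)–(62) p. 114, Rem. 12.9 p. 115.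
* [Deligne1971TravauxShimura] P. Deligne, *Travaux de Shimura*, Sém. Bourbaki 389 (1971), Prop. 5.11, (5.11.1), Cor. 5.7.
* [Liu2021] Y. Liu, *Fourier–Jacobi cycles and arithmetic relative trace formula*, App. C Rem. C.15.
-/


noncomputable section

open Function MulAction Topology NumberField IsDedekindDomain CategoryTheory CategoryTheory.Limits Matrix
  AlgebraicGeometry
open scoped Matrix ComplexOrder
open Literature.AlgebraicGeometry Literature.AlgebraicGeometry.Motives
open Literature.NumberTheory.Automorphic Literature.NumberTheory.Automorphic.UnitaryGroup
open Literature.NumberTheory.Automorphic.Liu2021.AppendixC (C5.OpenCompactSubgroup C5.SmallLevel)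
open Literature.Geometry.ComplexHyperbolic Literature.Geometry.ComplexHyperbolic.BallModel
open Literature.NumberTheory.Automorphic.ShimuraDissection
open Literature.NumberTheory.ComplexMultiplication (reflexNormFiniteIdele)
open Literature.NumberTheory.AdelicBaseChange (finiteIdeleRelNorm)

namespace Literature.AlgebraicGeometry.ShimuraVarieties.UnitaryCanonicalModel

/-! ## §0 Points of a form (skeleton §0) -/

/-- The points of an `E`-scheme `X` with values in the `E`-algebra `ℂ`, read as complex points of `X ⊗_E ℂ`
(`AlgPoints.baseChangeEquiv` along `algebraMap E ℂ`).  B-typ03's `Aux.pointsOfForm` is the case `E ⊂ ℂ` an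
intermediate field, and under `letI := ιE.toAlgebra` it is `AlgPoints.baseChangeEquiv ιE X` — both definitionally.
[folklore] -/
def formPointsEquiv {E : Type} [Field E] [Algebra E ℂ] (X : SchemeOver E) :
    ComplexPoints X ≃ ComplexPoints ((Motives.baseChangeHom (algebraMap E ℂ)).obj X) :=
  AlgPoints.baseChangeEquiv (algebraMap E ℂ) X

/-! ## §1 Reciprocity over a base `E` read through `ιE : E →+* ℂ` (skeleton §3) -/

/-- Shimura reciprocity (62) at the diagonal special pairs for an `E`-form `(M, e)` of the tower `Sc.Mc`, the base
`E` (embedding `ιE`) any field through which one reads the complex points — the formula of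
`UnitaryCanonicalModel.IsCanonicalDescentAt` with base `E` in place of `L` (consumer shape of A-plan1's
`stub_reflexCompositumModel`, verbatim).  At `E = L`, `ιE = τ` it IS `IsCanonicalDescentAt`
(`isCanonicalDescentOver_iff`).  A predicate; nothing asserted. [cite: Deligne1979ShimuraVarieties, 2.2.5]
[cite: Milne2005ShimuraVarieties, Def. 12.8, (62)] -/
def IsCanonicalDescentOver {L : Type} [Field L] [NumberField L] [IsCMField L] {H : Matrix (Fin 3) (Fin 3) L}
    {τ : L →+* ℂ} {T : GL (Fin 3) ℂ} {hT : formCongr (starRingEnd ℂ) T (H.map τ) = BallModel.J}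
    {K₀ : C5.OpenCompactSubgroup ↥(finAdelic (↥(maximalRealSubfield L)) L (IsCMField.complexConj L) 3 H)}
    (Sc : ComplexRecordSystem L H τ T hT K₀) {E : Type} [Field E] (ιE : E →+* ℂ)
    (M : C5.SmallLevel K₀ ⥤ SchemeOver E) (e : (M ⋙ Motives.baseChangeHom ιE) ≅ Sc.Mc) : Prop :=
  letI : Algebra E ℂ := ιE.toAlgebra
  ∀ (K : C5.SmallLevel K₀) (σ : ℂ ≃ₐ[E] ℂ) (s : (FiniteAdeleRing (𝓞 L) L)ˣ),
    IsArtinCorrespondent L τ s σ.toRingEquiv →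
    ∀ (v₃ : Fin 3 → L) (x : Ball), IsLinePoint L τ T v₃ x →
      ∀ d : finAdelic (↥(maximalRealSubfield L)) L (IsCMField.complexConj L) 3 H,
        IsDiagTwist L H v₃ (recipFactor L s) d →
        ∀ a : finAdelic (↥(maximalRealSubfield L)) L (IsCMField.complexConj L) 3 H,
          σ • (AlgPoints.baseChangeEquiv ιE (M.obj K)).symm
              (AlgPoints.map (e.inv.app K) ((Sc.pts K).symm (ShimuraSet.mk L H τ T hT K.1.1 x a))) =
            (AlgPoints.baseChangeEquiv ιE (M.obj K)).symm
              (AlgPoints.map (e.inv.app K) ((Sc.pts K).symm (ShimuraSet.mk L H τ T hT K.1.1 x (d * a))))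

/-- At base `E = L`, `ιE = τ`, `IsCanonicalDescentOver` is `IsCanonicalDescentAt` — Milne's (62) for the canonical model
itself — definitionally. [cite: Milne2005ShimuraVarieties, Def. 12.8 (62) p. 114] -/
theorem isCanonicalDescentOver_iff {L : Type} [Field L] [NumberField L] [IsCMField L] {H : Matrix (Fin 3) (Fin 3) L}
    {τ : L →+* ℂ} {T : GL (Fin 3) ℂ} {hT : formCongr (starRingEnd ℂ) T (H.map τ) = BallModel.J}
    {K₀ : C5.OpenCompactSubgroup ↥(finAdelic (↥(maximalRealSubfield L)) L (IsCMField.complexConj L) 3 H)}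
    (Sc : ComplexRecordSystem L H τ T hT K₀) (M : C5.SmallLevel K₀ ⥤ SchemeOver L)
    (e : (M ⋙ Motives.baseChangeHom τ) ≅ Sc.Mc) :
    IsCanonicalDescentOver Sc τ M e ↔ IsCanonicalDescentAt Sc M e :=
  Iff.rfl

/-- **Reciprocity up to Hecke translation by `Δ`** for a tower `N` of `E`-schemes whose complex fibres are `Δ` copies
of `Sc.Mc_K` (cofans `ι_K`): for `σ ∈ Aut(ℂ/ιE E)` with Artin correspondent `s`, a line point `x`, the diagonal
twist `d` by `r_x(s)`, every `a` and copy `δ`, `σ` sends the point over `([x, aK], δ)` to the point over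
`([x, d·aK], δ')` for SOME `δ'`.  This is the clause that F1 (`Aux.canonicalModel_exists_printed`, Deligne 1979
2.3.1 for `G̃ = G × T₀`, typer B-typ03) delivers with the PRECISE `δ' = r_Φ(s)·δ`; only «`∃ δ'`» is consumed
here.  A predicate; nothing asserted. [cite: Deligne1979ShimuraVarieties, 2.2.5, 2.3.1]
[cite: Deligne1971TravauxShimura, (5.11.1)] -/
def IsCanonicalDescentUpTo {L : Type} [Field L] [NumberField L] [IsCMField L] {H : Matrix (Fin 3) (Fin 3) L}
    {τ : L →+* ℂ} {T : GL (Fin 3) ℂ} {hT : formCongr (starRingEnd ℂ) T (H.map τ) = BallModel.J}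
    {K₀ : C5.OpenCompactSubgroup ↥(finAdelic (↥(maximalRealSubfield L)) L (IsCMField.complexConj L) 3 H)}
    (Sc : ComplexRecordSystem L H τ T hT K₀) {E : Type} [Field E] (ιE : E →+* ℂ) (Δ : Type)
    (N : C5.SmallLevel K₀ ⥤ SchemeOver E)
    (ι : ∀ K : C5.SmallLevel K₀, Δ → (Sc.Mc.obj K ⟶ (Motives.baseChangeHom ιE).obj (N.obj K))) : Prop :=
  letI : Algebra E ℂ := ιE.toAlgebra
  ∀ (K : C5.SmallLevel K₀) (σ : ℂ ≃ₐ[E] ℂ) (s : (FiniteAdeleRing (𝓞 L) L)ˣ),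
    IsArtinCorrespondent L τ s σ.toRingEquiv →
    ∀ (v₃ : Fin 3 → L) (x : Ball), IsLinePoint L τ T v₃ x →
      ∀ d : finAdelic (↥(maximalRealSubfield L)) L (IsCMField.complexConj L) 3 H,
        IsDiagTwist L H v₃ (recipFactor L s) d →
        ∀ (a : finAdelic (↥(maximalRealSubfield L)) L (IsCMField.complexConj L) 3 H) (δ : Δ), ∃ δ' : Δ,
          σ • (AlgPoints.baseChangeEquiv ιE (N.obj K)).symm
              (AlgPoints.map (ι K δ) ((Sc.pts K).symm (ShimuraSet.mk L H τ T hT K.1.1 x a))) =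
            (AlgPoints.baseChangeEquiv ιE (N.obj K)).symm
              (AlgPoints.map (ι K δ') ((Sc.pts K).symm (ShimuraSet.mk L H τ T hT K.1.1 x (d * a))))

/-! ## §2 Reciprocity over the enlarged reflex field `E♯ = Aux.reflexField L Φ τ` (skeleton §6, §7) -/

/-- **Reciprocity (62) for an `E♯`-form of `Sh(G,X)_ℂ = Sc.Mc` in B-typ03's conventions, WITHOUT the torus factor**:
`σ ∈ Aut(ℂ/E♯)`, `s` a finite idèle of `E♯` with `art_{E♯}(s) = σ|E♯^ab`, twist by `r_x(N_{E♯/τL} s)`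
(`recipFactor L (finiteIdeleRelNorm L E♯ s)`), points read through `Aux.pointsOfForm` — i.e. `Aux.IsCanonicalDescentAt`
with the summand index `p` and the torus idèle `t` deleted.  This is what the finite Hecke quotient produces from F1;
A-plan1's stub (A) at `E = E♯` is this up to the idèle-field passage J3 (transport along `τ : L ≃ E♯` in the Galois
leg).  A predicate; nothing asserted. [cite: Milne2005ShimuraVarieties, Def. 12.8 (60)–(62) p. 114]
[cite: Deligne1979ShimuraVarieties, 2.2.5] -/
def IsCanonicalDescentOverReflex {L : Type} [Field L] [NumberField L] [IsCMField L] {H : Matrix (Fin 3) (Fin 3) L}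
    {τ : L →+* ℂ} {T : GL (Fin 3) ℂ} {hT : formCongr (starRingEnd ℂ) T (H.map τ) = BallModel.J}
    {K₀ : C5.OpenCompactSubgroup ↥(finAdelic (↥(maximalRealSubfield L)) L (IsCMField.complexConj L) 3 H)}
    (Φ : CMType L) (Sc : ComplexRecordSystem L H τ T hT K₀)
    (M : C5.SmallLevel K₀ ⥤ SchemeOver ↥(Aux.reflexField L Φ τ))
    (e : (M ⋙ Motives.baseChange ↥(Aux.reflexField L Φ τ) ℂ) ≅ Sc.Mc) : Prop :=
  haveI : NumberField ↥(Aux.reflexField L Φ τ) := Aux.numberField_reflexField L Φ τ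
  letI : Algebra L ↥(Aux.reflexField L Φ τ) := (Aux.toReflexField L Φ τ).toAlgebra
  ∀ (K : C5.SmallLevel K₀) (σ : ℂ ≃ₐ[↥(Aux.reflexField L Φ τ)] ℂ)
    (s : (FiniteAdeleRing (𝓞 ↥(Aux.reflexField L Φ τ)) ↥(Aux.reflexField L Φ τ))ˣ),
    UnitaryCanonicalModel.IsArtinCorrespondent ↥(Aux.reflexField L Φ τ) (algebraMap ↥(Aux.reflexField L Φ τ) ℂ) s
        σ.toRingEquiv →
    ∀ (v₃ : Fin 3 → L) (x : Ball), IsLinePoint L τ T v₃ x →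
      ∀ d : finAdelic (↥(maximalRealSubfield L)) L (IsCMField.complexConj L) 3 H,
        IsDiagTwist L H v₃ (recipFactor L (finiteIdeleRelNorm L ↥(Aux.reflexField L Φ τ) s)) d →
        ∀ a : finAdelic (↥(maximalRealSubfield L)) L (IsCMField.complexConj L) 3 H,
          σ • (Aux.pointsOfForm (M.obj K)).symm
              (AlgPoints.map (e.inv.app K) ((Sc.pts K).symm (ShimuraSet.mk L H τ T hT K.1.1 x a))) =
            (Aux.pointsOfForm (M.obj K)).symm
              (AlgPoints.map (e.inv.app K) ((Sc.pts K).symm (ShimuraSet.mk L H τ T hT K.1.1 x (d * a))))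

/-- **Shimura reciprocity (62) over `E♯ ⊂ ℂ` with `L`-IDÈLES** for an `E♯`-form `(M, e : M ⊗_{E♯} ℂ ≅ Sc.Mc)`:
hDel's `IsCanonicalDescentAt` with the base `(L, τ)` replaced by the subfield `E♯ = Aux.reflexField L Φ τ` of `ℂ`
(canonical `Algebra ↥E♯ ℂ` instance; `σ` ranges over `Aut(ℂ/E♯) ⊆ Aut(ℂ/τL)`; points read through the form by
`Aux.pointsOfForm = AlgPoints.baseChangeEquiv (algebraMap ↥E♯ ℂ)`): for `art_L(s) = σ|L^ab`, `(v₃, x)` special,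
`d = r_x(s)`: `σ • [x, aK] = [x, d·aK]`.  This is the input of A-plan1's stub (A) `stub_reflexCompositumModel`
at `E = E♯` up to fan-A base-change bookkeeping (A-p06: `E ⊇ E♯`, `ιE`-generic phrasing).  A predicate; nothing
asserted. [cite: Milne2005ShimuraVarieties, Def. 12.8 (62) p. 114] [cite: Deligne1979ShimuraVarieties, 2.2.5] -/
def IsCanonicalDescentAtReflex {L : Type} [Field L] [NumberField L] [IsCMField L] {H : Matrix (Fin 3) (Fin 3) L}
    {τ : L →+* ℂ} {T : GL (Fin 3) ℂ} {hT : formCongr (starRingEnd ℂ) T (H.map τ) = BallModel.J}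
    {K₀ : C5.OpenCompactSubgroup ↥(finAdelic (↥(maximalRealSubfield L)) L (IsCMField.complexConj L) 3 H)}
    (Φ : CMType L) (Sc : ComplexRecordSystem L H τ T hT K₀)
    (M : C5.SmallLevel K₀ ⥤ SchemeOver ↥(Aux.reflexField L Φ τ))
    (e : (M ⋙ Motives.baseChange ↥(Aux.reflexField L Φ τ) ℂ) ≅ Sc.Mc) : Prop :=
  ∀ (K : C5.SmallLevel K₀) (σ : ℂ ≃ₐ[↥(Aux.reflexField L Φ τ)] ℂ) (s : (FiniteAdeleRing (𝓞 L) L)ˣ),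
    UnitaryCanonicalModel.IsArtinCorrespondent L τ s σ.toRingEquiv →
    ∀ (v₃ : Fin 3 → L) (x : Ball), IsLinePoint L τ T v₃ x →
      ∀ d : finAdelic (↥(maximalRealSubfield L)) L (IsCMField.complexConj L) 3 H,
        IsDiagTwist L H v₃ (recipFactor L s) d →
        ∀ a : finAdelic (↥(maximalRealSubfield L)) L (IsCMField.complexConj L) 3 H,
          σ • (Aux.pointsOfForm (M.obj K)).symm
              (AlgPoints.map (e.inv.app K) ((Sc.pts K).symm (ShimuraSet.mk L H τ T hT K.1.1 x a))) =
            (Aux.pointsOfForm (M.obj K)).symm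
              (AlgPoints.map (e.inv.app K) ((Sc.pts K).symm (ShimuraSet.mk L H τ T hT K.1.1 x (d * a))))

/-- **The junction one-liner (A-p06 (i))**: (62) over `E♯` with `L`-idèles in the canonical-instance phrasing
(`IsCanonicalDescentAtReflex`, typ03's conventions) IS the `ιE`-generic predicate of §3 / A-plan1's stub (A) inner
block at `E := ↥E♯`, `ιE := algebraMap ↥E♯ ℂ` (`letI := ιE.toAlgebra`): the two `Algebra ↥E♯ ℂ` structures agree by
structure eta (`rfl` at default transparency, NOT reducibly — farm-probed), and `Motives.baseChange ↥E♯ ℂ =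
Motives.baseChangeHom (algebraMap ↥E♯ ℂ)` is `rfl` (`baseChangeHom_algebraMap`). [cite: Milne2005ShimuraVarieties, Rem. 12.9 p. 115 («a model over a larger field E ⊇ E(G,X) satisfying (62) for σ fixing E»)] -/
theorem isCanonicalDescentAtReflex_iff_over {L : Type} [Field L] [NumberField L] [IsCMField L]
    {H : Matrix (Fin 3) (Fin 3) L} {τ : L →+* ℂ} {T : GL (Fin 3) ℂ}
    {hT : formCongr (starRingEnd ℂ) T (H.map τ) = BallModel.J}
    {K₀ : C5.OpenCompactSubgroup ↥(finAdelic (↥(maximalRealSubfield L)) L (IsCMField.complexConj L) 3 H)}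
    (Φ : CMType L) (Sc : ComplexRecordSystem L H τ T hT K₀)
    (M : C5.SmallLevel K₀ ⥤ SchemeOver ↥(Aux.reflexField L Φ τ))
    (e : (M ⋙ Motives.baseChange ↥(Aux.reflexField L Φ τ) ℂ) ≅ Sc.Mc) :
    IsCanonicalDescentAtReflex Φ Sc M e ↔
      IsCanonicalDescentOver Sc (algebraMap ↥(Aux.reflexField L Φ τ) ℂ) M e :=
  Iff.rfl

end Literature.AlgebraicGeometry.ShimuraVarieties.UnitaryCanonicalModel

end
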